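import Literature.AlgebraicTopology.SingularHomology.GysinMapDegreeOneIsoLocus
import HarnessLib

/-!
# Gysin homomorphisms and restriction to open subsets — the support form over self-injective rings
# (in particular modulo `m`)

Topic `Literature/AlgebraicTopology/SingularHomology` (theorems only). The named fact
`gysinMap_restrictCompl_eq_zero R` (`GysinMapSupport.lean`; W. Fulton, *Young Tableaux* (1997),
App. B §B.2 Exercise 5 with (26), (30): Borel–Moore proper push-forward commutes with restriction
to open subsets, in support form — *if `y ∈ Hᵃ(Y; R)` dies on `Y ∖ f⁻¹K` then `f_! y` dies on
`X ∖ K`*) is proved in the tree over FIELDS (`gysinMap_restrictCompl_eq_zero_of_field`). This file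
separates the two halves of that argument and extends the conclusion to every SELF-INJECTIVE
coefficient ring (Baer's criterion `Module.Baer R R`; T. Y. Lam, *Lectures on Modules and Rings*
(1999), §15: e.g. `ℤ/m`), which is what the modular questions of
`Summits/HodgeConjecture` (route GenericDivisibility) consume:

* `exists_isOpen_map_gysinMap_eq_zero_of_map_eq_zero` — ANY coefficient ring: if `y` dies on
  `Y ∖ f⁻¹K` then `f_! y` vanishes on an open neighbourhood of every compact `C ⊆ X ∖ K`
  (`y ⌢ [Y]` is carried by `Y ∖ f⁻¹C`, the tree's `ofAbsolute_capProduct_eq_zero_of_map_eq_zero`;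
  push forward: `f_! y ⌢ [X] = f_*(y ⌢ [Y])` is carried by `X ∖ C`; Čech–Poincaré duality along `C`,
  `exists_isOpen_map_eq_zero_of_ofAbsolute_capProduct_eq_zero`, Hatcher Thm. 3.44);
* `gysinMap_restrictCompl_eq_zero_of_baer` — **over a self-injective ring `R` the named fact's
  conclusion holds**: classes of the open `X ∖ K` vanishing near every compact subset vanish
  (`singularCohomology.map_subsetIncl_eq_zero_of_forall_isCompact`, Kronecker detection,
  `KroneckerInjectiveSelfInjective.lean`);
* `gysinMap_restrictCompl_eq_zero_zmod` — the case `R = ℤ/m`, `m ≠ 0`.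

(The named fact itself is typed for principal ideal DOMAINS, which `ℤ/m` is not; the statements
here repeat its body verbatim for the rings at hand.)

## References

* [FultonYoungTableaux1997] W. Fulton, Young Tableaux, CUP 1997, App. B §B.2 (26), (30), Exercise 5.
* [Fulton1998] W. Fulton, Intersection Theory, 2nd ed. 1998, §19.1 (1)–(6).
* [HatcherAT2002] A. Hatcher, Algebraic Topology, CUP 2002, §3.1 Thm. 3.2, §3.3 Thm. 3.44.
* [Lam1999] T. Y. Lam, Lectures on Modules and Rings, GTM 189 (1999), §3B Thm. 3.7, §15.
-/

noncomputable section

open CategoryTheory Limits Set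

universe u v

namespace Literature.AlgebraicTopology.SingularHomology

variable {R : Type v} [CommRing R]
variable {m n : ℕ} {Y X : Type u} [TopologicalSpace Y] [TopologicalSpace X] [CompactSpace X]
  [T2Space X] [ChartedSpace (EuclideanSpace ℝ (Fin n)) X]

/-- **If `y` dies on `Y ∖ f⁻¹K` then `f_! y` vanishes near every compact subset of `X ∖ K`, over
any coefficient ring.** For closed `R`-oriented manifolds `Y`, `X` (the orientation of `X`
satisfying Poincaré duality), `f : Y → X`, `K ⊆ X` closed, `y ∈ Hᵃ(Y; R)` with `y|_{Y ∖ f⁻¹K} = 0`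
and a compact `C ⊆ X ∖ K`: `y ⌢ [Y]` is carried by `Y ∖ f⁻¹C`
(`ofAbsolute_capProduct_eq_zero_of_map_eq_zero`), hence `f_! y ⌢ [X] = f_*(y ⌢ [Y])`
(`capProduct_gysinMap`, Fulton App. B §B.1 (5)) is carried by `X ∖ C`, and `f_! y` dies on a
neighbourhood of `C` by Čech–Poincaré duality along `C`
(`exists_isOpen_map_eq_zero_of_ofAbsolute_capProduct_eq_zero`, Hatcher Thm. 3.44).
[cite: FultonYoungTableaux1997, Appendix B §B.2 Exercise 5 with (26) and (30)]
[cite: HatcherAT2002, §3.3 Thm. 3.44] -/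
theorem exists_isOpen_map_gysinMap_eq_zero_of_map_eq_zero (μY : HomologicalOrientation R Y m)
    (μX : HomologicalOrientation R X n) (hX : μX.HasPoincareDuality) (f : C(Y, X)) {a b q : ℕ}
    (ha : a + q = m) (hb : b + q = n) {K : Set X} (hK : IsClosed K) (y : singularCohomology R R Y a)
    (hy : singularCohomology.map R R
      (⟨Subtype.val, continuous_subtype_val⟩ : C(↥(f ⁻¹' K)ᶜ, Y)) a y = 0)
    {C : Set X} (hC : IsCompact C) (hCK : C ⊆ Kᶜ) :
    ∃ V : Set X, IsOpen V ∧ C ⊆ V ∧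
      singularCohomology.map R R (⟨Subtype.val, continuous_subtype_val⟩ : C(↥V, X)) b
        (gysinMap μY μX f ha hb y) = 0 := by
  have hCcl : IsClosed C := hC.isClosed
  have hC' : IsClosed (f ⁻¹' C) := hCcl.preimage f.continuous
  have hC'K : f ⁻¹' C ⊆ (f ⁻¹' K)ᶜ := fun z hz hzK ↦ hCK hz hzK
  have hfC : MapsTo f (f ⁻¹' C)ᶜ Cᶜ := fun z hz ↦ hz
  -- `y ⌢ [Y]` is carried by `Y ∖ f⁻¹C`
  have h1 : relativeSingularHomology.ofAbsolute R R Y (f ⁻¹' C)ᶜ q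
      (capProduct ha y μY.fundamentalClass) = 0 :=
    ofAbsolute_capProduct_eq_zero_of_map_eq_zero hC' hC'K (hK.preimage f.continuous) ha y hy _
  -- hence `f_! y ⌢ [X] = f_*(y ⌢ [Y])` is carried by `X ∖ C`
  have h2 : relativeSingularHomology.ofAbsolute R R X Cᶜ q
      (capProduct hb (gysinMap μY μX f ha hb y) μX.fundamentalClass) = 0 := by
    rw [capProduct_gysinMap hX f ha hb y, ← ModuleCat.comp_apply,
      ← relativeSingularHomology.ofAbsolute_comp_map R R f hfC q, ModuleCat.comp_apply, h1, map_zero]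
  exact exists_isOpen_map_eq_zero_of_ofAbsolute_capProduct_eq_zero μX hCcl hb _ h2

/-- **Gysin homomorphisms are compatible with restriction to open subsets, support form, over a
self-injective ring** (the body of the named fact `gysinMap_restrictCompl_eq_zero`, Fulton App. B
§B.2 Exercise 5, for `R` with `Module.Baer R R`): if `y ∈ Hᵃ(Y; R)` dies on `Y ∖ f⁻¹K` then
`f_! y ∈ Hᵇ(X; R)` dies on `X ∖ K`. By the previous theorem `f_! y` dies near every compact subset
of `X ∖ K`, and over a self-injective ring such a class of the open `X ∖ K` vanishes
(`singularCohomology.map_subsetIncl_eq_zero_of_forall_isCompact`).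
[cite: FultonYoungTableaux1997, Appendix B §B.2 Exercise 5 with (26) and (30)]
[cite: HatcherAT2002, §3.1 Thm. 3.2 and §3.3 Thm. 3.44] [cite: Lam1999, §3B Thm. 3.7] -/
theorem gysinMap_restrictCompl_eq_zero_of_baer (hR : Module.Baer R R)
    (μY : HomologicalOrientation R Y m) (μX : HomologicalOrientation R X n)
    (hX : μX.HasPoincareDuality) (f : C(Y, X)) {a b q : ℕ} (ha : a + q = m) (hb : b + q = n)
    {K : Set X} (hK : IsClosed K) (y : singularCohomology R R Y a)
    (hy : singularCohomology.map R R
      (⟨Subtype.val, continuous_subtype_val⟩ : C(↥(f ⁻¹' K)ᶜ, Y)) a y = 0) :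
    singularCohomology.map R R (⟨Subtype.val, continuous_subtype_val⟩ : C(↥Kᶜ, X)) b
      (gysinMap μY μX f ha hb y) = 0 :=
  singularCohomology.map_subsetIncl_eq_zero_of_forall_isCompact hR _ fun _ hC hCK ↦
    exists_isOpen_map_gysinMap_eq_zero_of_map_eq_zero μY μX hX f ha hb hK y hy hC hCK

/-- **The case `R = ℤ/m` (`m ≠ 0`)**: if `y ∈ Hᵃ(Y; ℤ/m)` dies on `Y ∖ f⁻¹K` then `f_! y` dies on
`X ∖ K` (`ℤ/m` is self-injective, `ZMod.baer_self`). [cite: FultonYoungTableaux1997, Appendix B §B.2 Exercise 5 with (26) and (30)]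
[cite: Lam1999, §15] -/
theorem gysinMap_restrictCompl_eq_zero_zmod (k : ℕ) [NeZero k]
    (μY : HomologicalOrientation (ZMod k) Y m) (μX : HomologicalOrientation (ZMod k) X n)
    (hX : μX.HasPoincareDuality) (f : C(Y, X)) {a b q : ℕ} (ha : a + q = m) (hb : b + q = n)
    {K : Set X} (hK : IsClosed K) (y : singularCohomology (ZMod k) (ZMod k) Y a)
    (hy : singularCohomology.map (ZMod k) (ZMod k)
      (⟨Subtype.val, continuous_subtype_val⟩ : C(↥(f ⁻¹' K)ᶜ, Y)) a y = 0) :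
    singularCohomology.map (ZMod k) (ZMod k) (⟨Subtype.val, continuous_subtype_val⟩ : C(↥Kᶜ, X)) b
      (gysinMap μY μX f ha hb y) = 0 :=
  gysinMap_restrictCompl_eq_zero_of_baer (ZMod.baer_self k) μY μX hX f ha hb hK y hy

end Literature.AlgebraicTopology.SingularHomology

end
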